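/-
Origin: expansion seat `planner-pub-hodgecm-pv05-g4-0`, handover #4 2026-08-18T08:05:35Z (`HOME/pub-hodgecm-pv05-g4/lean/Pv05g4/FockSeesawGL2.lean`, md5 6eb0ffcf, 277 lines);
landed by the gen-7 packager in gate run 26 as `HodgeCM/PerL34/FockSeesawGL2.lean` (import ^import Pv[0-9]+g[0-9]+\.→import HodgeCM.PerL34. ×1).
-/
/-
Origin: HOME/pub-hodgecm-pv05-g4/lean/Pv05g4/FockSeesawGL2.lean — session planner-pub-hodgecm-pv05-g4-0 (unit pub-hodgecm-pv05-g4,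
DAG-node prover #05 gen 4), node `FockSeesaw` part 4.  Intended final place: `HodgeCM/PerL34/FockSeesawGL2.lean`.
Imports this seat's `FockSeesawDualPair` (packager rewrite `^import Pv05g4\.FockSeesawDualPair$` ↦
`import HodgeCM.PerL34.FockSeesawDualPair`) and two Mathlib modules; asserts nothing, cites nothing.
-/
import Summits.HodgeConjecture.HodgeCM.PerL34.FockSeesawDualPair
import Mathlib.RingTheory.Derivation.Lie
import Mathlib.Algebra.MvPolynomial.Derivation

set_option autoImplicit false

/-!
# Lemma 3.4 (seesaw) at `ι₁`, part 4: `𝔲(W)_ℂ = 𝔤𝔩₂` acts — the `𝔤𝔩₂` relations of pv12's `EW j j'`, the Lie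
# homomorphism `EWRep : 𝔤𝔩₂(ℂ) → End ℂ[z_{aj}, w_j]`, and `[EWRep B, ω_W(A)] = 0` for all `B ∈ 𝔤𝔩₂`, `A ∈ 𝔤𝔩₃`

pv12's `ArchB.EW j j' = Σ_a z_{aj} ∂_{z_{aj'}} − w_{j'} ∂_{w_j}` are first-order operators without constant term, i.e.
DERIVATIONS of the plane model (`EWDer`).  The commutator of two derivations is a derivation and a derivation of a
polynomial ring is determined by its values on the variables (`MvPolynomial.derivation_ext`), where `EW j j'` acts as the
matrix unit `E_{jj'}` on the `z`-columns and as `−E_{j'j}` on the `w`'s (`EW_X_inl`, `EW_X_inr`).  Hence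

* `EW_comm : [EW j j', EW l l'] = δ_{j'l} EW j l' − δ_{l'j} EW l j'` — the `𝔤𝔩₂` relations (16 pairs, checked on 6 variables);
* `EWRep : Matrix (Fin 2) (Fin 2) ℂ →ₗ⁅ℂ⁆ Module.End ℂ PlaneModel`, `EWRep (E_{jj'}) = EW j j'` — `𝔲(W)_ℂ` ACTS (Lie hom),
  built exactly like pv05-g3's `oscRep`;
* `EWRep_comm_planeOscRep : EWRep B * planeOscRep A = planeOscRep A * EWRep B` — with part 3's `EW_comm_planeOsc`:
  the two Lie algebra actions `(𝔤𝔩₂, 𝔤𝔩₃) = (𝔲(W)_ℂ, 𝔲(V)_ℂ)` on `ℂ[z_{aj}, w_j]` COMMUTE (a dual pair inside `𝔰𝔭(𝕎)_ℂ`,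
  polynomial Fock model at `ι₁`);
* `EW_zero_one/one_zero/self_mem_biPiece`, `EWRep_mem_sup_biPiece`: `E^W_{01} (F_k ⊗ F_l) ⊆ F_{k+1} ⊗ F_{l−1}`,
  `E^W_{10} (F_k ⊗ F_l) ⊆ F_{k−1} ⊗ F_{l+1}`, `E^W_{jj}` preserves — `U(W)` moves between the `T`-types of part 2
  (from the weight commutators `weightOp_colWt_comm_EW`, no monomial bookkeeping).

KERNEL, hypothesis-free.  PRINT residual: none new.  PACKAGER: additive leaf; ONE import rewrite; lands after
`FockSeesawDualPair.lean`; axioms trio; uses `attribute [local instance 100] LieRing.ofAssociativeRing` file-locally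
exactly as `FockGL3` / `FockSeesaw` do (the commutator Lie ring on an associative ring; adds no axiom).
-/

namespace HodgeCM
namespace PerL34
namespace Fock

open MvPolynomial

attribute [local instance 100] LieRing.ofAssociativeRing

/-! ## 1. `EW j j'` is a derivation; its values on the variables -/

section Der

/-- pv12's `EW j j'` as a derivation of `ℂ[z_{aj}, w_j]`. -/
noncomputable def EWDer (j j' : Fin 2) : Derivation ℂ PlaneModel PlaneModel :=
  z 0 j • pderiv (Sum.inl (0, j')) + z 1 j • pderiv (Sum.inl (1, j')) - w j' • pderiv (Sum.inr j)

/-- (Ported verbatim from the HodgeCMPerL package; no docstring in the source.) -/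
theorem EWDer_apply (j j' : Fin 2) (f : PlaneModel) : EWDer j j' f = EW j j' f := by
  rw [EW_apply]
  rfl

/-- (Ported verbatim from the HodgeCMPerL package; no docstring in the source.) -/
theorem coe_EWDer (j j' : Fin 2) : ((EWDer j j' : Derivation ℂ PlaneModel PlaneModel) : Module.End ℂ PlaneModel) = EW j j' :=
  LinearMap.ext (EWDer_apply j j')

/-- Leibniz rule for `EW j j'`. -/
theorem EW_mul (j j' : Fin 2) (f g : PlaneModel) : EW j j' (f * g) = f * EW j j' g + g * EW j j' f := by
  rw [← EWDer_apply, ← EWDer_apply, ← EWDer_apply, Derivation.leibniz, smul_eq_mul, smul_eq_mul]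

/-- `EW j j'` on the `z`-variables: the matrix unit `E_{jj'}` acting on the column index. -/
theorem EW_X_inl (j j' b l : Fin 2) :
    EW j j' (X (Sum.inl (b, l)) : PlaneModel) = if l = j' then X (Sum.inl (b, j)) else 0 := by
  fin_cases j <;> fin_cases j' <;> fin_cases b <;> fin_cases l <;>
    simp [EW_apply, pderiv_X, z, w]

/-- `EW j j'` on the `w`-variables: `−E_{j'j}`. -/
theorem EW_X_inr (j j' l : Fin 2) :
    EW j j' (X (Sum.inr l) : PlaneModel) = if l = j then -X (Sum.inr j') else 0 := by
  fin_cases j <;> fin_cases j' <;> fin_cases l <;>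
    simp [EW_apply, pderiv_X, z, w]

end Der

/-! ## 2. The `𝔤𝔩₂` relations -/

section GL2

/-- (Ported verbatim from the HodgeCMPerL package; no docstring in the source.) -/
theorem EWDer_lie (j j' l l' : Fin 2) :
    ⁅EWDer j j', EWDer l l'⁆ = (if j' = l then EWDer j l' else 0) - (if l' = j then EWDer l j' else 0) := by
  refine MvPolynomial.derivation_ext fun v => ?_
  rw [Derivation.commutator_apply, Derivation.sub_apply]
  rcases v with ⟨b, m⟩ | m
  · fin_cases j <;> fin_cases j' <;> fin_cases l <;> fin_cases l' <;> fin_cases b <;> fin_cases m <;>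
      simp [EWDer_apply, EW_X_inl]
  · fin_cases j <;> fin_cases j' <;> fin_cases l <;> fin_cases l' <;> fin_cases m <;>
      simp [EWDer_apply, EW_X_inr]

/-- **The `𝔤𝔩₂` commutation relations** of pv12's `U(2)_W`-operators:
`[E^W_{jj'}, E^W_{ll'}] = δ_{j'l} E^W_{jl'} − δ_{l'j} E^W_{lj'}`. -/
theorem EW_comm (j j' l l' : Fin 2) :
    EW j j' * EW l l' - EW l l' * EW j j' = (if j' = l then EW j l' else 0) - (if l' = j then EW l j' else 0) := by
  have h := congrArg (fun D : Derivation ℂ PlaneModel PlaneModel => (D : Module.End ℂ PlaneModel)) (EWDer_lie j j' l l')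
  simp only [Derivation.commutator_coe_linear_map, coe_EWDer, LieRing.of_associative_ring_bracket] at h
  rw [h]
  split_ifs <;> simp [coe_EWDer]

/-- Linear extension of `EW` to `𝔤𝔩₂ = Matrix (Fin 2) (Fin 2) ℂ`. -/
noncomputable def EWLin : Matrix (Fin 2) (Fin 2) ℂ →ₗ[ℂ] Module.End ℂ PlaneModel where
  toFun B := ∑ j, ∑ j', B j j' • EW j j'
  map_add' B B' := by
    simp only [Matrix.add_apply, add_smul, Finset.sum_add_distrib]
  map_smul' c B := by
    simp only [Matrix.smul_apply, smul_eq_mul, mul_smul, RingHom.id_apply, Finset.smul_sum]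

/-- (Ported verbatim from the HodgeCMPerL package; no docstring in the source.) -/
theorem EWLin_apply (B : Matrix (Fin 2) (Fin 2) ℂ) : EWLin B = ∑ j, ∑ j', B j j' • EW j j' := rfl

/-- (Ported verbatim from the HodgeCMPerL package; no docstring in the source.) -/
theorem EWLin_single (j j' : Fin 2) (c : ℂ) : EWLin (Matrix.single j j' c) = c • EW j j' := by
  rw [EWLin_apply, Finset.sum_eq_single j, Finset.sum_eq_single j']
  · rw [Matrix.single_apply_same]
  · intro k _ hk
    rw [Matrix.single_apply_of_ne, zero_smul]
    exact fun h => hk h.2.symm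
  · intro h; exact absurd (Finset.mem_univ j') h
  · intro k _ hk
    refine Finset.sum_eq_zero fun k' _ => ?_
    rw [Matrix.single_apply_of_ne, zero_smul]
    exact fun h => hk h.1.symm
  · intro h; exact absurd (Finset.mem_univ j) h

/-- **`𝔲(W)_ℂ = 𝔤𝔩₂(ℂ)` acts on the plane Fock model**: the Lie algebra homomorphism extending `E_{jj'} ↦ EW j j'`
(pattern of pv05-g3's `oscRep`, kernel-checked on the 16 pairs of matrix units via `EW_comm`). -/
noncomputable def EWRep : Matrix (Fin 2) (Fin 2) ℂ →ₗ⁅ℂ⁆ Module.End ℂ PlaneModel :=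
  { EWLin with
    map_lie' := by
      intro A B
      let L₁ : Matrix (Fin 2) (Fin 2) ℂ →ₗ[ℂ] Matrix (Fin 2) (Fin 2) ℂ →ₗ[ℂ] Module.End ℂ PlaneModel :=
        LinearMap.mk₂ ℂ (fun A B => EWLin ⁅A, B⁆) (fun A₁ A₂ B => by rw [add_lie, map_add])
          (fun c A B => by rw [smul_lie, map_smul]) (fun A B₁ B₂ => by rw [lie_add, map_add])
          (fun c A B => by rw [lie_smul, map_smul])
      let L₂ : Matrix (Fin 2) (Fin 2) ℂ →ₗ[ℂ] Matrix (Fin 2) (Fin 2) ℂ →ₗ[ℂ] Module.End ℂ PlaneModel :=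
        LinearMap.mk₂ ℂ (fun A B => ⁅EWLin A, EWLin B⁆) (fun A₁ A₂ B => by rw [map_add, add_lie])
          (fun c A B => by
            simp only [map_smul, LieRing.of_associative_ring_bracket, smul_sub, smul_mul_assoc, mul_smul_comm])
          (fun A B₁ B₂ => by rw [map_add, lie_add])
          (fun c A B => by
            simp only [map_smul, LieRing.of_associative_ring_bracket, smul_sub, smul_mul_assoc, mul_smul_comm])
      have key : L₁ = L₂ := by
        refine LinearMap.ext_basis (Matrix.stdBasis ℂ (Fin 2) (Fin 2)) (Matrix.stdBasis ℂ (Fin 2) (Fin 2))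
          fun p q => ?_
        obtain ⟨i, j⟩ := p
        obtain ⟨k, l⟩ := q
        simp only [L₁, L₂, LinearMap.mk₂_apply, Matrix.stdBasis_eq_single, LieRing.of_associative_ring_bracket,
          map_sub, EWLin_single, one_smul, EW_comm]
        by_cases hjk : j = k
        · subst hjk
          by_cases hli : l = i
          · subst hli
            simp [EWLin_single]
          · rw [Matrix.single_mul_single_same, Matrix.single_mul_single_of_ne (h := hli), if_neg hli]
            simp [EWLin_single]
        · by_cases hli : l = i
          · subst hli
            rw [Matrix.single_mul_single_same, Matrix.single_mul_single_of_ne (h := hjk), if_neg hjk]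
            simp [EWLin_single]
          · rw [Matrix.single_mul_single_of_ne (h := hjk), Matrix.single_mul_single_of_ne (h := hli), if_neg hjk,
              if_neg hli]
            simp
      exact LinearMap.congr_fun₂ key A B }

/-- (Ported verbatim from the HodgeCMPerL package; no docstring in the source.) -/
theorem EWRep_apply (B : Matrix (Fin 2) (Fin 2) ℂ) : EWRep B = ∑ j, ∑ j', B j j' • EW j j' := rfl

/-- (Ported verbatim from the HodgeCMPerL package; no docstring in the source.) -/
theorem EWRep_single (j j' : Fin 2) : EWRep (Matrix.single j j' (1 : ℂ)) = EW j j' := by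
  change EWLin _ = _
  rw [EWLin_single, one_smul]

/-- The centre `𝟙 ∈ 𝔤𝔩₂` acts as the total `T`-weight `colWt 0 + colWt 1` (= `rowWt 0 + rowWt 1 + wWt`-free form):
`EWRep 1 = weightOp (colWt 0) + weightOp (colWt 1)`. -/
theorem EWRep_one : EWRep (1 : Matrix (Fin 2) (Fin 2) ℂ) = weightOp (colWt 0) + weightOp (colWt 1) := by
  rw [EWRep_apply, Fin.sum_univ_two, Fin.sum_univ_two, Fin.sum_univ_two]
  simp [EW_self_eq_weightOp]

end GL2

/-! ## 3. The two actions commute -/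

section DualPair

/-- **`(𝔲(W)_ℂ, 𝔲(V)_ℂ) = (𝔤𝔩₂, 𝔤𝔩₃)` act as commuting Lie algebras on `ℂ[z_{aj}, w_j]`.** -/
theorem EWRep_comm_planeOscRep (B : Matrix (Fin 2) (Fin 2) ℂ) (A : Matrix HarmVar HarmVar ℂ) :
    EWRep B * planeOscRep A = planeOscRep A * EWRep B := by
  rw [EWRep_apply, Finset.sum_mul, Finset.mul_sum]
  refine Finset.sum_congr rfl fun j _ => ?_
  rw [Finset.sum_mul, Finset.mul_sum]
  refine Finset.sum_congr rfl fun j' _ => ?_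
  rw [smul_mul_assoc, mul_smul_comm, EW_comm_planeOscRep]

/-- (Ported verbatim from the HodgeCMPerL package; no docstring in the source.) -/
theorem EWRep_lie_planeOscRep (B : Matrix (Fin 2) (Fin 2) ℂ) (A : Matrix HarmVar HarmVar ℂ) :
    ⁅EWRep B, planeOscRep A⁆ = 0 := by
  rw [LieRing.of_associative_ring_bracket, EWRep_comm_planeOscRep, sub_self]

/-- Every `𝔤𝔩₃`-stable subspace is carried to a `𝔤𝔩₃`-stable subspace by every element of `𝔲(W)_ℂ`. -/
theorem planeOscRep_map_EWRep_mem {M : Submodule ℂ PlaneModel}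
    (hM : ∀ A : Matrix HarmVar HarmVar ℂ, ∀ f ∈ M, planeOscRep A f ∈ M) (B : Matrix (Fin 2) (Fin 2) ℂ)
    (A : Matrix HarmVar HarmVar ℂ) : ∀ f ∈ M.map (EWRep B), planeOscRep A f ∈ M.map (EWRep B) := by
  rintro f ⟨g, hg, rfl⟩
  refine ⟨planeOscRep A g, hM A g hg, ?_⟩
  have h := LinearMap.congr_fun (EWRep_comm_planeOscRep B A) g
  simpa only [Module.End.mul_apply] using h

end DualPair

/-! ## 4. `U(W)` moves the `T`-types: `E^W_{01} : F_k ⊗ F_l → F_{k+1} ⊗ F_{l−1}`, `E^W_{10}` the other way -/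

section Shift

/-- `[W_i, E^W_{jj'}] = (δ_{ij} − δ_{j'i}) E^W_{jj'}`: the weight commutators, from `EW_comm`. -/
theorem weightOp_colWt_comm_EW (i j j' : Fin 2) :
    (weightOp (colWt i) : Module.End ℂ PlaneModel) * EW j j' - EW j j' * weightOp (colWt i) =
      (if i = j then EW j j' else 0) - (if j' = i then EW j j' else 0) := by
  rw [← EW_self_eq_weightOp, EW_comm]
  by_cases h1 : i = j
  · subst h1
    by_cases h2 : j' = i
    · subst h2; rfl
    · rw [if_neg h2, if_neg h2]
  · rw [if_neg h1, if_neg h1]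
    by_cases h2 : j' = i
    · subst h2; rfl
    · rw [if_neg h2, if_neg h2]

/-- (Ported verbatim from the HodgeCMPerL package; no docstring in the source.) -/
private theorem shift_aux {W E : Module.End ℂ PlaneModel} {f : PlaneModel} {c : ℂ} (d : ℂ) (hc : W f = c • f)
    (h : (W * E - E * W) f = d • E f) : W (E f) = (c + d) • E f := by
  rw [LinearMap.sub_apply, Module.End.mul_apply, Module.End.mul_apply, hc, map_smul, sub_eq_iff_eq_add] at h
  rw [h]
  module

/-- **`E^W_{01} : F_k ⊗ F_l → F_{k+1} ⊗ F_{l−1}`.** -/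
theorem EW_zero_one_mem_biPiece {k l : ℤ} {f : PlaneModel} (hf : f ∈ biPiece k l) :
    EW 0 1 f ∈ biPiece (k + 1) (l - 1) := by
  rw [mem_biPiece_iff] at hf ⊢
  obtain ⟨h0, h1⟩ := hf
  have e0 := shift_aux (E := EW 0 1) (1 : ℂ) h0 (by rw [weightOp_colWt_comm_EW]; simp)
  have e1 := shift_aux (E := EW 0 1) (-1 : ℂ) h1 (by rw [weightOp_colWt_comm_EW]; simp)
  refine ⟨?_, ?_⟩
  · rw [e0]; push_cast; module
  · rw [e1]; push_cast; module

/-- **`E^W_{10} : F_k ⊗ F_l → F_{k−1} ⊗ F_{l+1}`.** -/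
theorem EW_one_zero_mem_biPiece {k l : ℤ} {f : PlaneModel} (hf : f ∈ biPiece k l) :
    EW 1 0 f ∈ biPiece (k - 1) (l + 1) := by
  rw [mem_biPiece_iff] at hf ⊢
  obtain ⟨h0, h1⟩ := hf
  have e0 := shift_aux (E := EW 1 0) (-1 : ℂ) h0 (by rw [weightOp_colWt_comm_EW]; simp)
  have e1 := shift_aux (E := EW 1 0) (1 : ℂ) h1 (by rw [weightOp_colWt_comm_EW]; simp)
  refine ⟨?_, ?_⟩
  · rw [e0]; push_cast; module
  · rw [e1]; push_cast; module

/-- `E^W_{jj}` preserves each `F_k ⊗ F_l` (it is `W_j`). -/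
theorem EW_self_mem_biPiece {k l : ℤ} {f : PlaneModel} (hf : f ∈ biPiece k l) (j : Fin 2) :
    EW j j f ∈ biPiece k l := by
  rw [EW_self_eq_weightOp]
  have hj : j = 0 ∨ j = 1 := by fin_cases j <;> simp
  rcases hj with rfl | rfl
  · rw [weightOp_colWt_zero_of_mem_biPiece hf]; exact Submodule.smul_mem _ _ hf
  · rw [weightOp_colWt_one_of_mem_biPiece hf]; exact Submodule.smul_mem _ _ hf

/-- Hence every element of `𝔲(W)_ℂ` maps `F_k ⊗ F_l` into `F_{k−1} ⊗ F_{l+1} ⊕ F_k ⊗ F_l ⊕ F_{k+1} ⊗ F_{l−1}`. -/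
theorem EWRep_mem_sup_biPiece {k l : ℤ} {f : PlaneModel} (hf : f ∈ biPiece k l) (B : Matrix (Fin 2) (Fin 2) ℂ) :
    EWRep B f ∈ biPiece (k - 1) (l + 1) ⊔ biPiece k l ⊔ biPiece (k + 1) (l - 1) := by
  rw [EWRep_apply, Fin.sum_univ_two, Fin.sum_univ_two, Fin.sum_univ_two]
  simp only [LinearMap.add_apply, LinearMap.smul_apply]
  refine Submodule.add_mem _ (Submodule.add_mem _ ?_ ?_) (Submodule.add_mem _ ?_ ?_)
  · exact Submodule.smul_mem _ _ (Submodule.mem_sup_left (Submodule.mem_sup_right (EW_self_mem_biPiece hf 0)))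
  · exact Submodule.smul_mem _ _ (Submodule.mem_sup_right (EW_zero_one_mem_biPiece hf))
  · exact Submodule.smul_mem _ _ (Submodule.mem_sup_left (Submodule.mem_sup_left (EW_one_zero_mem_biPiece hf)))
  · exact Submodule.smul_mem _ _ (Submodule.mem_sup_left (Submodule.mem_sup_right (EW_self_mem_biPiece hf 1)))

end Shift

end Fock
end PerL34
end HodgeCM
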